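import Summits.KontsevichZagierPeriods.KontsevichZagierPeriods.Theorems.TerasomaMultiplicationBetaCancellationFibredPiCancellation
import Summits.KontsevichZagierPeriods.KontsevichZagierPeriods.Theorems.BetaCancellation.Negative.Torsion

/-!
# Side-descent finish for the central band

Stub `stub_sideFinishBand` of the crux line `dirichlet-companion-to-pi` (`--supports`
stmt-KontsevichZagierPeriods-13633). Write `D` for the unit disc (`piRep`, integrand `1`),
`S_A = D ∩ {x < -1/2}` (`piRep.slabRestrict (-2) (-1/2)`), `B = D ∩ {|x| < 1/2}` (the central
band) and `S_E = D ∩ {1/2 < x}`. Cutting `D` at the two rational chords `x = ±1/2` (domain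
additivity, the chords being Lebesgue-null) gives `[D] − [S_A] − [B] − [S_E] ∈ relations`; the
mirror hypothesis (`x ↦ -x`) gives `[S_A] − [S_E] ∈ relations`; hence `[π]·c ∈ relations` and
`[B]·c ∈ relations` give `2 • ([S_A]·c) ∈ relations`, so `[S_A]·c ∈ relations` by
torsion-freeness of `FormalRep ⧸ relations` (`nsmul_mem_relations_iff`), and the one-segment
descent of seat c7 (Archimedes' trisection, `stub_archimedesOfTriangle stub_triangleConst`)
concludes `c ∈ relations`.
-/

noncomputable section

-- `Summit.KontsevichZagierPeriods.KontsevichZagierPeriods.…` is the tree's mandated layout (single-conjunct summit).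
set_option linter.dupNamespace false

namespace Summit.KontsevichZagierPeriods.KontsevichZagierPeriods.BetaCancellationLine

open Set MeasureTheory
open Literature.NumberTheory.Transcendental
open Literature.NumberTheory.Transcendental.KZ
open Summit.KontsevichZagierPeriods.KontsevichZagierPeriods.BetaCancellationNegative
  (volume_setOf_apply_eq_zero nsmul_mem_relations_iff)

/-- **The right slab is the right segment plus the band**: for a central band `B`
(`B.domain = D ∩ {-1/2 < x < 1/2}`, integrand `1`),
`[D ∩ {-1/2 < x < 2}] − [D ∩ {-1/2 < x < 2} ∩ {1/2 < x < 2}] − [B] ∈ relations`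
(cutting at the rational parameter value `x = 1/2`; the chord `x = 1/2` is null). [folklore] -/
theorem sideBand_of_discR_sub_of_segE_sub_of_band_mem (DB : IntegralRep 2)
    (hDBd : DB.domain = piDisc ∩ {z | z 0 ∈ Set.Ioo (-1/2 : ℝ) (1/2)})
    (hDBi : DB.integrand = fun _ => 1) :
    of (piRep.slabRestrict (-1/2) 2) - of ((piRep.slabRestrict (-1/2) 2).slabRestrict (1/2) 2) -
      of DB ∈ relations := by
  -- cut `[D ∩ {-1/2 < x < 2}]` at the slab `{1/2 < x < 2}`
  have h1 := domainAddRel_subset_relations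
    (IntegralRep.of_sub_of_slabRestrict_sub_of_slabCompl_mem (piRep.slabRestrict (-1/2) 2) (1/2) 2)
  -- the complement `D ∩ {-1/2 < x ≤ 1/2}` is the band up to the null chord `x = 1/2`
  have hsub : DB.domain ⊆ ((piRep.slabRestrict (-1/2) 2).slabCompl (1/2) 2).domain := by
    intro z hz
    rw [hDBd] at hz
    obtain ⟨hd, hgt, hlt⟩ := hz
    rw [mem_piDisc] at hd
    rw [IntegralRep.domain_slabCompl]
    refine ⟨(mem_discR_domain z).2 ⟨hd, by linarith, by linarith⟩, fun h => ?_⟩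
    rw [mem_paramSlab] at h
    push_cast at h
    linarith [h.1]
  have hvol : volume (((piRep.slabRestrict (-1/2) 2).slabCompl (1/2) 2).domain \ DB.domain) = 0 := by
    refine measure_mono_null (fun z hz => ?_) (volume_setOf_apply_eq_zero (0 : Fin 2) (1/2))
    obtain ⟨hz1, hz2⟩ := hz
    rw [IntegralRep.domain_slabCompl] at hz1
    obtain ⟨hR, hc⟩ := hz1
    rw [mem_discR_domain] at hR
    obtain ⟨hd, hgt, -⟩ := hR
    rw [mem_paramSlab] at hc
    push_cast at hc
    have hle : z 0 ≤ 1 := by nlinarith [sq_nonneg (z 1), sq_nonneg (z 0 - 1)]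
    have h1' : z 0 ≤ 1/2 := by
      by_contra h
      push Not at h
      exact hc ⟨by linarith, by linarith⟩
    have h2' : 1/2 ≤ z 0 := by
      by_contra h
      push Not at h
      refine hz2 ?_
      rw [hDBd]
      exact ⟨(mem_piDisc z).2 hd, by linarith, h⟩
    show z 0 = 1/2
    exact le_antisymm h1' h2'
  have h2 := ((piRep.slabRestrict (-1/2) 2).slabCompl (1/2) 2).of_sub_of_restrict_mem_relations
    DB.isSemialgebraic_domain hsub hvol
  have e : ((piRep.slabRestrict (-1/2) 2).slabCompl (1/2) 2).restrict DB.domain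
      DB.isSemialgebraic_domain hsub = DB :=
    IntegralRep.ext' rfl hDBi.symm
  rw [e] at h2
  have e2 : of (piRep.slabRestrict (-1/2) 2) - of ((piRep.slabRestrict (-1/2) 2).slabRestrict (1/2) 2) -
      of DB =
      (of (piRep.slabRestrict (-1/2) 2) - of ((piRep.slabRestrict (-1/2) 2).slabRestrict (1/2) 2) -
          of ((piRep.slabRestrict (-1/2) 2).slabCompl (1/2) 2)) +
        (of ((piRep.slabRestrict (-1/2) 2).slabCompl (1/2) 2) - of DB) := by
    abel
  rw [e2]
  exact relations.add_mem h1 h2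

/-- The right segment cut out of the right slab, `D ∩ {-1/2 < x < 2} ∩ {1/2 < x < 2}`, is the
mirror image `D ∩ {-x ∈ (-2, -1/2)}` of the left segment `S_A = D ∩ {x ∈ (-2, -1/2)}` (as sets).
[folklore] -/
theorem sideBand_domain_segE :
    ((piRep.slabRestrict (-1/2) 2).slabRestrict (1/2) 2).domain =
      piDisc ∩ {z | -z 0 ∈ Set.Ioo ((-2 : ℚ) : ℝ) ((-1/2 : ℚ) : ℝ)} := by
  ext z
  simp only [IntegralRep.domain_slabRestrict, piRep_domain, mem_inter_iff, mem_paramSlab,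
    mem_setOf_eq, mem_Ioo]
  push_cast
  constructor
  · rintro ⟨⟨hd, -, -⟩, h3, h4⟩
    exact ⟨hd, by linarith, by linarith⟩
  · rintro ⟨hd, h3, h4⟩
    exact ⟨⟨hd, by linarith, by linarith⟩, by linarith, by linarith⟩

/-- STUB (side-descent finish for the central band): if the mirror move is available, then
`[D ∩ {|x| < 1/2}]·c ∈ relations` and `[π]·c ∈ relations` force `c ∈ relations`
(`[D] = [S_A] + [band] + [S_E]`, `[S_E] ∼ [S_A]` by the mirror, torsion-freeness, Archimedes).
[folklore] -/
theorem stub_sideFinishBand :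
    (∀ (S : Set ℝ) (DS DS' : IntegralRep 2), DS.domain = piDisc ∩ {z | z 0 ∈ S} → DS'.domain = piDisc ∩ {z | -z 0 ∈ S} → (DS.integrand = fun _ => 1) → (DS'.integrand = fun _ => 1) → of DS - of DS' ∈ relations) → ∀ (DB : IntegralRep 2), DB.domain = piDisc ∩ {z | z 0 ∈ Set.Ioo (-1/2 : ℝ) (1/2)} → (DB.integrand = fun _ => 1) → ∀ c : FormalRep, of DB * c ∈ relations → of piRep * c ∈ relations → c ∈ relations := by
  intro hM DB hDBd hDBi c hB hc
  -- the mirror: `[S_A] − [S_E] ∈ relations`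
  have hAE : of (piRep.slabRestrict (-2) (-1/2)) -
      of ((piRep.slabRestrict (-1/2) 2).slabRestrict (1/2) 2) ∈ relations :=
    hM (Set.Ioo ((-2 : ℚ) : ℝ) ((-1/2 : ℚ) : ℝ)) (piRep.slabRestrict (-2) (-1/2))
      ((piRep.slabRestrict (-1/2) 2).slabRestrict (1/2) 2) rfl sideBand_domain_segE rfl rfl
  -- `[π] − [B] − [S_A] − [S_A] ∈ relations`
  have hY : of piRep - of DB - of (piRep.slabRestrict (-2) (-1/2)) -
      of (piRep.slabRestrict (-2) (-1/2)) ∈ relations := by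
    have h := relations.sub_mem (relations.add_mem of_piRep_sub_of_slabs_mem_relations
      (sideBand_of_discR_sub_of_segE_sub_of_band_mem DB hDBd hDBi)) hAE
    have e : of piRep - of DB - of (piRep.slabRestrict (-2) (-1/2)) -
        of (piRep.slabRestrict (-2) (-1/2)) =
        of piRep - of (piRep.slabRestrict (-2) (-1/2)) - of (piRep.slabRestrict (-1/2) 2) +
          (of (piRep.slabRestrict (-1/2) 2) -
            of ((piRep.slabRestrict (-1/2) 2).slabRestrict (1/2) 2) - of DB) -
          (of (piRep.slabRestrict (-2) (-1/2)) -
            of ((piRep.slabRestrict (-1/2) 2).slabRestrict (1/2) 2)) := by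
      abel
    rw [e]
    exact h
  -- `2 • ([S_A]·c) ∈ relations`, hence `[S_A]·c ∈ relations` (torsion-freeness)
  have hA : of (piRep.slabRestrict (-2) (-1/2)) * c ∈ relations := by
    have hYc := mul_mem_relations_right_holds _ c hY
    have h2 : 2 • (of (piRep.slabRestrict (-2) (-1/2)) * c) ∈ relations := by
      have e : 2 • (of (piRep.slabRestrict (-2) (-1/2)) * c) =
          of piRep * c - of DB * c -
            (of piRep - of DB - of (piRep.slabRestrict (-2) (-1/2)) -
              of (piRep.slabRestrict (-2) (-1/2))) * c := by
        simp only [sub_mul, two_nsmul]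
        abel
      rw [e]
      exact relations.sub_mem (relations.sub_mem hc hB) hYc
    exact (nsmul_mem_relations_iff two_ne_zero _).1 h2
  -- the one-segment descent of seat c7
  have hX := mul_mem_relations_right_holds _ c of_piRep_sub_of_slabs_mem_relations
  have hD : of (piRep.slabRestrict (-1/2) 2) * c ∈ relations := by
    have e : of (piRep.slabRestrict (-1/2) 2) * c =
        of piRep * c - of (piRep.slabRestrict (-2) (-1/2)) * c -
          (of piRep - of (piRep.slabRestrict (-2) (-1/2)) - of (piRep.slabRestrict (-1/2) 2)) * c := by
      simp only [sub_mul]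
      abel
    rw [e]
    exact relations.sub_mem (relations.sub_mem hc hA) hX
  exact stub_archimedesOfTriangle stub_triangleConst c hA hD

end Summit.KontsevichZagierPeriods.KontsevichZagierPeriods.BetaCancellationLine
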